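import Summits.AtomisticToContinuum.FouriersLaw.Theorems.JunctionLocalityNonBallisticLightConeAssemblyPart2e
import Summits.AtomisticToContinuum.FouriersLaw.Theorems.JunctionLocalityNonBallisticLightConeAssemblyPart1
import Summits.AtomisticToContinuum.FouriersLaw.Theorems.JunctionLocalityNonBallisticLightConePropagation
import Summits.AtomisticToContinuum.FouriersLaw.Theorems.JunctionLocalityNonBallisticLightConeKinematics
import Summits.AtomisticToContinuum.FouriersLaw.Theorems.JunctionLocalityNonBallisticLightConeMomentumTail
import Summits.AtomisticToContinuum.FouriersLaw.Theorems.JunctionLocalityNonBallisticGibbsExpMomentGrowth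
import Summits.AtomisticToContinuum.FouriersLaw.Theorems.JunctionLocalityNonBallisticStubLightConeWindowAux3
import Mathlib.Analysis.SpecificLimits.Normed

/-!
# `NonBallistic` / light cone, assembly part 2f: the light-cone window modulo the fourth moment of the far current

Helper (`--supports stmt-AtomisticToContinuum-9127`) for stub `stub_lightConeWindow` (LC) of line `contact-current-forgetting`.
The single-flip estimate (part 2e) is fed with the LANDED pieces — propagation (`chainFlow_momentumFlip_propagation`),
kinematics (`pinnedChain_chainFlow_position_sq_le`), momentum tail (`pinnedChain_prob_timeIntegral_momentum_sq_gt_le`),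
Gibbs energy tail (`pinnedChain_gibbsExpMomentGrowth`) — and the scales `Λ_N = √N`, `K N` (energy), so that the cone radius
is `R_N² = O(√N)`, the cone term is `O(N³4^{−N})` and the bad event has probability `O(e^{−N} + 1/N)`:

* `single_flip_small` — for every `t⋆, ε > 0` there is `N₀` with
  `∫⁻ x, ∫⁻ ω, (j_{N−2}(Φ_s(Θ_{i₀}x)) − j_{N−2}(Φ_s x))² ≤ ε` for `N ≥ N₀`, `i₀ ≤ 1`, `s ≤ t⋆`;
* `pathwise_flipInsensitivity_of_fourthMoment` — the double flip `Θ₀Θ₁` (triangle inequality + flip invariance), i.e.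
  the hypothesis of `flipInsensitivity_of_pathwise` (part 1);
* `stub_lightConeWindow_of_fourthMoment` — the registered stub VERBATIM, via `lightConeWindow_of_flipInsensitivity`;

all modulo ONE remaining static input, the `N`-uniform fourth Gibbs moment of the far current
`FarCurrentFourthMoment` (piece FS-D2, with a worker).
-/

noncomputable section

namespace Summit.AtomisticToContinuum.FouriersLaw.Theorems.NonBallistic

open MeasureTheory ProbabilityTheory Set Filter Topology
open scoped NNReal ENNReal
open Literature.MathematicalPhysics.KineticTheory.HeatConduction
open Literature.Probability.Process
open Summit.AtomisticToContinuum.FouriersLaw.Theorems.SubdiffusiveBondHeat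
open Summit.AtomisticToContinuum.FouriersLaw.Theorems.JunctionLocality

namespace FSAssembly

/-- Piece FS-D2 (static): the fourth Gibbs moment of the far bond current is bounded uniformly in `N`. -/
def FarCurrentFourthMoment : Prop :=
  ∀ ω₂ lam β γ : ℝ, 0 < ω₂ → 0 < lam → 0 < β → 0 < γ → ∀ T : ℝ, 0 < T →
    ∃ C₄ : ℝ, ∀ (N : ℕ) (k : Fin N), 2 ≤ N → k.val = N - 2 →
      Integrable (fun x => (pinnedChain ω₂ lam β γ).bondCurrent N k x ^ 4) ((pinnedChain ω₂ lam β γ).gibbsMeasure N T) ∧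
        ∫ x, (pinnedChain ω₂ lam β γ).bondCurrent N k x ^ 4 ∂((pinnedChain ω₂ lam β γ).gibbsMeasure N T) ≤ C₄

/-- Elementary asymptotics of the scales: with `c₁ ≥ 0` and `R_N = √(c₁√N) + 1`, for `N ≥ 1`,
`R_N² ≤ (2c₁ + 2)·N` and `R_N² ≤ 2c₁√N + 2`. -/
theorem sq_radius_le {c₁ : ℝ} (hc₁ : 0 ≤ c₁) {N : ℕ} (hN : 1 ≤ N) :
    (Real.sqrt (c₁ * Real.sqrt N) + 1) ^ 2 ≤ 2 * c₁ * Real.sqrt N + 2 ∧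
      (Real.sqrt (c₁ * Real.sqrt N) + 1) ^ 2 ≤ (2 * c₁ + 2) * N := by
  have hN1 : (1 : ℝ) ≤ N := by exact_mod_cast hN
  have hsN : 1 ≤ Real.sqrt N := by rw [← Real.sqrt_one]; exact Real.sqrt_le_sqrt hN1
  have hsNN : Real.sqrt N ≤ N := by
    have := Real.sqrt_le_sqrt (show (N : ℝ) ≤ (N : ℝ) ^ 2 by nlinarith)
    rwa [Real.sqrt_sq (by linarith)] at this
  have hρ : 0 ≤ c₁ * Real.sqrt N := by positivity
  have h1 : (Real.sqrt (c₁ * Real.sqrt N) + 1) ^ 2 ≤ 2 * c₁ * Real.sqrt N + 2 := by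
    have hs := Real.sq_sqrt hρ
    nlinarith [sq_nonneg (Real.sqrt (c₁ * Real.sqrt N) - 1), Real.sqrt_nonneg (c₁ * Real.sqrt N)]
  refine ⟨h1, h1.trans ?_⟩
  nlinarith [mul_le_mul_of_nonneg_left hsNN hc₁]

/-- The three smallness conditions hold for all large `N`: the cone condition `6eAt·R_N² ≤ N − 3`, the cone term
`C_X N³ 4^{−N} < ε/2` and the bad term `4√(C₄(e^{−N} + 2C_B/N)) < ε/2`. -/
theorem eventually_small {A t c₁ CX C₄ CB ε : ℝ} (hA : 0 ≤ A) (ht : 0 ≤ t) (hc₁ : 0 ≤ c₁) (hε : 0 < ε) :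
    ∀ᶠ N : ℕ in atTop, 4 ≤ N ∧
      2 * Real.exp 1 * (3 * (A * (Real.sqrt (c₁ * Real.sqrt N) + 1) ^ 2) * t) ≤ (N : ℝ) - 3 ∧
      CX * ((N : ℝ) ^ 3 * (1 / 4 : ℝ) ^ N) < ε / 2 ∧
      4 * Real.sqrt (C₄ * (Real.exp (-(N : ℝ)) + 2 * CB / N)) < ε / 2 := by
  -- (i) the cone condition: (a√N + b)/N → 0
  set a : ℝ := 12 * Real.exp 1 * A * t * c₁ with ha
  set b : ℝ := 12 * Real.exp 1 * A * t + 3 with hb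
  have ha0 : 0 ≤ a := by positivity
  have hb0 : 0 ≤ b := by positivity
  have hsqrt : Tendsto (fun N : ℕ => Real.sqrt N) atTop atTop :=
    Real.tendsto_sqrt_atTop.comp tendsto_natCast_atTop_atTop
  have hcone : Tendsto (fun N : ℕ => a / Real.sqrt N + b / N) atTop (𝓝 0) := by
    have h1 : Tendsto (fun N : ℕ => a / Real.sqrt N) atTop (𝓝 0) := tendsto_const_nhds.div_atTop hsqrt
    have h2 : Tendsto (fun N : ℕ => b / (N : ℝ)) atTop (𝓝 0) := tendsto_const_div_atTop_nhds_zero_nat b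
    simpa using h1.add h2
  have ev1 : ∀ᶠ N : ℕ in atTop, a / Real.sqrt N + b / N < 1 := hcone.eventually (Iio_mem_nhds one_pos)
  -- (ii) the cone term
  have hX : Tendsto (fun N : ℕ => CX * ((N : ℝ) ^ 3 * (1 / 4 : ℝ) ^ N)) atTop (𝓝 0) := by
    have := (tendsto_pow_const_mul_const_pow_of_abs_lt_one 3
      (show |(1 / 4 : ℝ)| < 1 by rw [abs_of_nonneg (by norm_num)]; norm_num)).const_mul CX
    simpa using this
  have ev2 : ∀ᶠ N : ℕ in atTop, CX * ((N : ℝ) ^ 3 * (1 / 4 : ℝ) ^ N) < ε / 2 :=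
    hX.eventually (Iio_mem_nhds (by positivity))
  -- (iii) the bad term
  have hY : Tendsto (fun N : ℕ => 4 * Real.sqrt (C₄ * (Real.exp (-(N : ℝ)) + 2 * CB / N))) atTop (𝓝 0) := by
    have h1 : Tendsto (fun N : ℕ => Real.exp (-(N : ℝ))) atTop (𝓝 0) :=
      Real.tendsto_exp_neg_atTop_nhds_zero.comp tendsto_natCast_atTop_atTop
    have h2 : Tendsto (fun N : ℕ => 2 * CB / (N : ℝ)) atTop (𝓝 0) := tendsto_const_div_atTop_nhds_zero_nat _
    have h3 : Tendsto (fun N : ℕ => C₄ * (Real.exp (-(N : ℝ)) + 2 * CB / N)) atTop (𝓝 0) := by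
      simpa using (h1.add h2).const_mul C₄
    have h4 : Tendsto (fun N : ℕ => Real.sqrt (C₄ * (Real.exp (-(N : ℝ)) + 2 * CB / N))) atTop (𝓝 0) := by
      have := (Real.continuous_sqrt.tendsto 0).comp h3
      rw [Real.sqrt_zero] at this
      exact this
    simpa using h4.const_mul 4
  have ev3 : ∀ᶠ N : ℕ in atTop, 4 * Real.sqrt (C₄ * (Real.exp (-(N : ℝ)) + 2 * CB / N)) < ε / 2 :=
    hY.eventually (Iio_mem_nhds (by positivity))
  have ev4 : ∀ᶠ N : ℕ in atTop, 4 ≤ N := eventually_ge_atTop 4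
  filter_upwards [ev1, ev2, ev3, ev4] with N h1 h2 h3 h4
  refine ⟨h4, ?_, h2, h3⟩
  have hN1 : (1 : ℕ) ≤ N := le_trans (by norm_num) h4
  have hNpos : (0 : ℝ) < N := by exact_mod_cast lt_of_lt_of_le (by norm_num) h4
  have hsq := (sq_radius_le hc₁ hN1).1
  have hsN0 : 0 < Real.sqrt N := Real.sqrt_pos.mpr hNpos
  -- from h1: a√N + b < N
  have hab : a * Real.sqrt N + b < N := by
    have e1 : a / Real.sqrt N = a * Real.sqrt N / N := by
      rw [div_eq_div_iff hsN0.ne' hNpos.ne']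
      calc a * N = a * (Real.sqrt N * Real.sqrt N) := by rw [Real.mul_self_sqrt hNpos.le]
        _ = a * Real.sqrt N * Real.sqrt N := by ring
    rw [e1, ← add_div, div_lt_one hNpos] at h1
    exact h1
  calc 2 * Real.exp 1 * (3 * (A * (Real.sqrt (c₁ * Real.sqrt N) + 1) ^ 2) * t)
      = 6 * Real.exp 1 * A * t * (Real.sqrt (c₁ * Real.sqrt N) + 1) ^ 2 := by ring
    _ ≤ 6 * Real.exp 1 * A * t * (2 * c₁ * Real.sqrt N + 2) :=
        mul_le_mul_of_nonneg_left hsq (by positivity)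
    _ = a * Real.sqrt N + b - 3 := by simp only [ha, hb]; ring
    _ ≤ (N : ℝ) - 3 := by linarith

variable {ω₂ lam β γ : ℝ} (hω : 0 < ω₂) (hl : 0 < lam) (hβ : 0 < β) (hγ : 0 < γ) {T : ℝ} (hT : 0 < T)

include hω hl hβ hγ hT in
/-- **Single flip, small.** Modulo `FarCurrentFourthMoment`: for every `t⋆` and `ε > 0` there is `N₀` such that for
`N ≥ N₀`, `i₀ ≤ 1`, `k = N − 2` and `s ≤ t⋆`,
`∫⁻ x, ∫⁻ ω, (j_k(Φ_s(Θ_{i₀}x, Bω)) − j_k(Φ_s(x, Bω)))² dW dμ_T ≤ ε`. -/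
theorem single_flip_small (hD2 : FarCurrentFourthMoment) (tstar ε : ℝ) (hε : 0 < ε) :
    ∃ N₀ : ℕ, ∀ (N : ℕ) (i₀ k : Fin N), N₀ ≤ N → i₀.val ≤ 1 → k.val = N - 2 → ∀ s : ℝ≥0, (s : ℝ) ≤ tstar →
      ∫⁻ x, ∫⁻ ω, ENNReal.ofReal
          (((pinnedChain ω₂ lam β γ).bondCurrent N k
              ((pinnedChain ω₂ lam β γ).solMap N T T s (momentumFlip i₀ x) (pairPath ω)) -
            (pinnedChain ω₂ lam β γ).bondCurrent N k
              ((pinnedChain ω₂ lam β γ).solMap N T T s x (pairPath ω))) ^ 2)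
          ∂wienerPair ∂((pinnedChain ω₂ lam β γ).gibbsMeasure N T) ≤ ENNReal.ofReal ε := by
  set P := pinnedChain ω₂ lam β γ with hP
  -- the pieces and their constants
  obtain ⟨A, hA0, hA⟩ := chainFlow_momentumFlip_propagation ω₂ lam β γ hω hl.le hβ.le hγ.le
  have hB := pinnedChain_chainFlow_position_sq_le ω₂ lam β γ hω hl.le hβ.le hγ.le
  obtain ⟨CB, hCB0, hC⟩ := pinnedChain_prob_timeIntegral_momentum_sq_gt_le ω₂ lam β γ hω hl.le hβ.le hγ.le T hT
  have hϑ0 : (0 : ℝ) ≤ 1 / (2 * T) := by positivity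
  have hϑ1 : 1 / (2 * T) < 1 / T := one_div_lt_one_div_of_lt hT (by linarith)
  obtain ⟨c, hc⟩ := pinnedChain_gibbsExpMomentGrowth ω₂ lam β γ hω hl.le hβ.le T (1 / (2 * T)) hT hϑ0 hϑ1
  obtain ⟨C₄', hC₄'⟩ := hD2 ω₂ lam β γ hω hl hβ hγ T hT
  set C₄ : ℝ := max C₄' 0 with hC₄
  have hC₄0 : 0 ≤ C₄ := le_max_right _ _
  -- scales
  set t : ℝ := max tstar 1 with htdef
  have ht0 : 0 ≤ t := le_trans zero_le_one (le_max_right _ _)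
  have ht1 : 1 ≤ t := le_max_right _ _
  set K : ℝ := max (2 * T * (c + 1)) 0 with hKdef
  have hK0 : 0 ≤ K := le_max_right _ _
  have hcK : c - 1 / (2 * T) * K ≤ -1 := by
    have h1 : 1 / (2 * T) * (2 * T * (c + 1)) = c + 1 := by field_simp
    have h2 : 1 / (2 * T) * (2 * T * (c + 1)) ≤ 1 / (2 * T) * K :=
      mul_le_mul_of_nonneg_left (le_max_left _ _) hϑ0
    linarith
  set c₁ : ℝ := 4 * Real.sqrt (K / lam) + 2 * t with hc₁def
  have hc₁0 : 0 ≤ c₁ := by positivity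
  set CX : ℝ := (56 * (1 + β)) ^ 2 * (195 * T ^ 2 + 32) * ((2 * c₁ + 2) ^ 3 * 64) with hCXdef
  -- the eventual smallness
  obtain ⟨N₀, hN₀⟩ := eventually_atTop.1
    (eventually_small (CX := CX) (C₄ := C₄) (CB := CB * t ^ 4) hA0.le ht0 hc₁0 hε)
  refine ⟨N₀, fun N i₀ k hN hi₀ hk s hs => ?_⟩
  obtain ⟨hN4, hcone, hXε, hYε⟩ := hN₀ N hN
  have hN1 : 1 ≤ N := by omega
  have hNpos : (0 : ℝ) < N := by exact_mod_cast (show 0 < N by omega)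
  have hkN : k.val + 1 < N := by omega
  have hik : i₀.val < k.val := by omega
  -- the radius and the scales at this N
  set Λ : ℝ := Real.sqrt N with hΛ
  have hΛ0 : 0 < Λ := Real.sqrt_pos.mpr hNpos
  have hρ : 4 * Real.sqrt (K * N / lam) + 2 * t * Λ = c₁ * Real.sqrt N := by
    have : Real.sqrt (K * N / lam) = Real.sqrt (K / lam) * Real.sqrt N := by
      rw [← Real.sqrt_mul (div_nonneg hK0 hl.le)]; congr 1; ring
    rw [this, hc₁def]; ring
  set R : ℝ := Real.sqrt (4 * Real.sqrt (K * N / lam) + 2 * t * Λ) + 1 with hRdef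
  have hR' : R = Real.sqrt (c₁ * Real.sqrt N) + 1 := by rw [hRdef, hρ]
  -- the exceptional set of the momentum tail
  set E : Set (PhaseSpace N × WienerPair) :=
    {q | ∃ i : Fin N, Λ < ∫ r in (0:ℝ)..t, (P.solMap N T T r q.1 (pairPath q.2)).2 i ^ 2} with hEdef
  have hEm : MeasurableSet E := by
    have : E = ⋃ i : Fin N, {q | Λ < ∫ r in (0:ℝ)..t, (P.solMap N T T r q.1 (pairPath q.2)).2 i ^ 2} := by
      ext q; simp [hEdef]
    rw [this]
    exact MeasurableSet.iUnion fun i => measurableSet_lt measurable_const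
      (pinnedChain_measurable_timeIntegral_momentum_pow hω hl.le hβ.le hγ.le N T T t i 2)
  have hEπ : ((P.gibbsMeasure N T).prod wienerPair) E ≤ ENNReal.ofReal (CB * t ^ 4 / N) := by
    refine (hC N t Λ ht0 hΛ0).trans (le_of_eq ?_)
    congr 1
    have hΛ4 : Λ ^ 4 = (N : ℝ) ^ 2 := by
      rw [show (4:ℕ) = 2 * 2 by rfl, pow_mul, hΛ, Real.sq_sqrt hNpos.le]
    rw [hΛ4]; field_simp
  have hE : ∀ q ∉ E, ∀ i : Fin N, ∫ r in (0:ℝ)..t, (P.solMap N T T r q.1 (pairPath q.2)).2 i ^ 2 ≤ Λ := by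
    intro q hq i
    by_contra h
    exact hq ⟨i, lt_of_not_ge h⟩
  -- the Gibbs energy tail
  have hB₁ : P.gibbsMeasure N T {x | K * N < P.hamiltonian N x} ≤ ENNReal.ofReal (Real.exp (-(N : ℝ))) := by
    refine ((hc N K).2.2).trans (ENNReal.ofReal_le_ofReal (Real.exp_le_exp.mpr ?_))
    have := mul_le_mul_of_nonneg_right hcK hNpos.le
    linarith
  -- the fourth moment of the far current
  have hD2N : Integrable (fun x => P.bondCurrent N k x ^ 4) (P.gibbsMeasure N T) ∧
      ∫ x, P.bondCurrent N k x ^ 4 ∂(P.gibbsMeasure N T) ≤ C₄ := by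
    obtain ⟨h1, h2⟩ := hC₄' N k (by omega) hk
    exact ⟨h1, h2.trans (le_max_left _ _)⟩
  -- the cone condition for (i₀, k)
  have hcone' : 2 * Real.exp 1 * (3 * (A * R ^ 2) * t) ≤ ((k.val - i₀.val : ℕ) : ℝ) := by
    rw [hR']
    refine hcone.trans ?_
    have h3 : N - 3 ≤ k.val - i₀.val := by omega
    have : ((N - 3 : ℕ) : ℝ) ≤ ((k.val - i₀.val : ℕ) : ℝ) := by exact_mod_cast h3
    refine le_trans ?_ this
    rw [Nat.cast_sub (by omega)]
    norm_num
  -- the single-flip estimate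
  have hkin : ∀ (x : PhaseSpace N) (η : ℝ → Fin N → ℝ), Continuous η → ∀ t : ℝ, 0 ≤ t →
      ∀ s ∈ Set.Icc 0 t, ∀ i : Fin N,
        (P.chainFlow N x η s).1 i ^ 2 ≤ 2 * (x.1 i) ^ 2 + 2 * t * ∫ u in (0:ℝ)..t, ((P.chainFlow N x η u).2 i) ^ 2 :=
    fun x η hη t _ s hs i => (hB N x η hη t s hs i).2
  have est := single_flip_estimate hω hl hβ hγ hT i₀ k hkN hik hA0.le ht0 (Real.exp_pos _).le
    (by positivity : (0:ℝ) ≤ CB * t ^ 4 / N) hC₄0 (hA N) hkin E hEm hEπ hE hB₁ hD2N hRdef hcone' s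
    (hs.trans (le_max_left _ _))
  refine est.trans ?_
  -- the two terms are small
  have hX : (56 * (1 + β) * R ^ 3 * (1 / 2) ^ (k.val - i₀.val)) ^ 2 * (195 * T ^ 2 + 32) ≤
      CX * ((N : ℝ) ^ 3 * (1 / 4 : ℝ) ^ N) := by
    have hR0 : 0 ≤ R := by rw [hRdef]; positivity
    have hR2 : R ^ 2 ≤ (2 * c₁ + 2) * N := by rw [hR']; exact (sq_radius_le hc₁0 hN1).2
    have hR6 : R ^ 6 ≤ (2 * c₁ + 2) ^ 3 * (N : ℝ) ^ 3 := by
      calc R ^ 6 = (R ^ 2) ^ 3 := by ring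
        _ ≤ ((2 * c₁ + 2) * N) ^ 3 := pow_le_pow_left₀ (sq_nonneg _) hR2 3
        _ = _ := by ring
    have hhalf : (1 / 2 : ℝ) ^ (k.val - i₀.val) ≤ (1 / 2) ^ (N - 3) :=
      pow_le_pow_of_le_one (by norm_num) (by norm_num) (by omega)
    have hhalf2 : ((1 / 2 : ℝ) ^ (N - 3)) ^ 2 = 64 * (1 / 4 : ℝ) ^ N := by
      obtain ⟨m, rfl⟩ : ∃ m, N = m + 3 := ⟨N - 3, by omega⟩
      have e1 : ((1 / 2 : ℝ) ^ m) ^ 2 = (1 / 4 : ℝ) ^ m := by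
        rw [← pow_mul, mul_comm, pow_mul]; norm_num
      rw [Nat.add_sub_cancel, e1, pow_add]
      ring
    have h0 : 0 ≤ (1 / 2 : ℝ) ^ (k.val - i₀.val) := by positivity
    calc (56 * (1 + β) * R ^ 3 * (1 / 2) ^ (k.val - i₀.val)) ^ 2 * (195 * T ^ 2 + 32)
        = (56 * (1 + β)) ^ 2 * (195 * T ^ 2 + 32) * (R ^ 6 * ((1 / 2 : ℝ) ^ (k.val - i₀.val)) ^ 2) := by ring
      _ ≤ (56 * (1 + β)) ^ 2 * (195 * T ^ 2 + 32) * (((2 * c₁ + 2) ^ 3 * (N : ℝ) ^ 3) * ((1 / 2 : ℝ) ^ (N - 3)) ^ 2) := by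
          refine mul_le_mul_of_nonneg_left ?_ (by positivity)
          exact mul_le_mul hR6 (pow_le_pow_left₀ h0 hhalf 2) (by positivity) (by positivity)
      _ = CX * ((N : ℝ) ^ 3 * (1 / 4 : ℝ) ^ N) := by rw [hhalf2, hCXdef]; ring
  have hY : 4 * Real.sqrt (C₄ * (Real.exp (-(N : ℝ)) + 2 * (CB * t ^ 4 / N))) ≤
      4 * Real.sqrt (C₄ * (Real.exp (-(N : ℝ)) + 2 * (CB * t ^ 4) / N)) := by
    have e : (2 : ℝ) * (CB * t ^ 4 / N) = 2 * (CB * t ^ 4) / N := by ring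
    rw [e]
  calc ENNReal.ofReal ((56 * (1 + β) * R ^ 3 * (1 / 2) ^ (k.val - i₀.val)) ^ 2 * (195 * T ^ 2 + 32)) +
        ENNReal.ofReal (4 * Real.sqrt (C₄ * (Real.exp (-(N : ℝ)) + 2 * (CB * t ^ 4 / N))))
      ≤ ENNReal.ofReal (ε / 2) + ENNReal.ofReal (ε / 2) :=
        add_le_add (ENNReal.ofReal_le_ofReal (hX.trans hXε.le)) (ENNReal.ofReal_le_ofReal (hY.trans hYε.le))
    _ = ENNReal.ofReal ε := by rw [← ENNReal.ofReal_add (by positivity) (by positivity)]; ring_nf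

include hω hl hβ hγ in
/-- A measurability helper: the single-flip integrand is jointly measurable. -/
theorem measurable_flipDiff_sq {N : ℕ} (i₀ k : Fin N) (s : ℝ≥0) :
    Measurable fun q : PhaseSpace N × WienerPair => ENNReal.ofReal
      (((pinnedChain ω₂ lam β γ).bondCurrent N k
          ((pinnedChain ω₂ lam β γ).solMap N T T s (momentumFlip i₀ q.1) (pairPath q.2)) -
        (pinnedChain ω₂ lam β γ).bondCurrent N k
          ((pinnedChain ω₂ lam β γ).solMap N T T s q.1 (pairPath q.2))) ^ 2) := by
  set P := pinnedChain ω₂ lam β γ with hP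
  have hzm : Measurable fun q : PhaseSpace N × WienerPair => P.solMap N T T s q.1 (pairPath q.2) :=
    pinnedChain_measurable_solMap_pairPath hω hl.le hβ.le hγ.le N T T s
  have hΘm : Measurable fun q : PhaseSpace N × WienerPair => (momentumFlip i₀ q.1, q.2) :=
    ((measurable_momentumFlip i₀).comp measurable_fst).prodMk measurable_snd
  have hz'm : Measurable fun q : PhaseSpace N × WienerPair => P.solMap N T T s (momentumFlip i₀ q.1) (pairPath q.2) := by
    have h := hzm.comp hΘm
    exact h
  have hjm : Measurable (P.bondCurrent N k) := (pinnedChain_continuous_bondCurrent ω₂ lam β γ N k).measurable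
  have hJm : Measurable fun q : PhaseSpace N × WienerPair => P.bondCurrent N k (P.solMap N T T s q.1 (pairPath q.2)) := by
    have h := hjm.comp hzm
    exact h
  have hJ'm : Measurable fun q : PhaseSpace N × WienerPair =>
      P.bondCurrent N k (P.solMap N T T s (momentumFlip i₀ q.1) (pairPath q.2)) := by
    have h := hjm.comp hz'm
    exact h
  exact ENNReal.measurable_ofReal.comp ((hJ'm.sub hJm).pow_const 2)

/-- **The pathwise flip-insensitivity** (hypothesis of `flipInsensitivity_of_pathwise`), modulo `FarCurrentFourthMoment`:
the double flip `Θ₀Θ₁` costs at most twice two single flips (flip invariance of `μ_T` moves the start `Θ₁x` back to `x`). -/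
theorem pathwise_flipInsensitivity_of_fourthMoment (hD2 : FarCurrentFourthMoment) :
    ∀ ω₂ lam β γ : ℝ, 0 < ω₂ → 0 < lam → 0 < β → 0 < γ → ∀ T : ℝ, 0 < T → ∀ tstar ε : ℝ, 0 < ε →
      ∃ N₀ : ℕ, ∀ (N : ℕ) (i i' k : Fin N), N₀ ≤ N → (i : ℕ) = 0 → (i' : ℕ) = 1 → (k : ℕ) = N - 2 →
        ∀ s : NNReal, (s : ℝ) ≤ tstar →
          ∫⁻ x, ∫⁻ ω, ENNReal.ofReal
              (((pinnedChain ω₂ lam β γ).bondCurrent N k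
                  ((pinnedChain ω₂ lam β γ).solMap N T T s x (pairPath ω)) -
                (pinnedChain ω₂ lam β γ).bondCurrent N k
                  ((pinnedChain ω₂ lam β γ).solMap N T T s (momentumFlip i (momentumFlip i' x)) (pairPath ω))) ^ 2)
              ∂wienerPair ∂((pinnedChain ω₂ lam β γ).gibbsMeasure N T) ≤ ENNReal.ofReal ε := by
  intro ω₂ lam β γ hω hl hβ hγ T hT tstar ε hε
  obtain ⟨N₀, hN₀⟩ := single_flip_small hω hl hβ hγ hT hD2 tstar (ε / 4) (by positivity)
  refine ⟨N₀, fun N i i' k hN hi hi' hk s hs => ?_⟩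
  set P := pinnedChain ω₂ lam β γ with hP
  set μ := P.gibbsMeasure N T with hμ
  have S1 := hN₀ N i' k hN (by omega) hk s hs
  have S0 := hN₀ N i k hN (by omega) hk s hs
  -- the three currents
  set J : PhaseSpace N × WienerPair → ℝ := fun q => P.bondCurrent N k (P.solMap N T T s q.1 (pairPath q.2)) with hJ
  set F₁ : PhaseSpace N × WienerPair → ℝ≥0∞ := fun q =>
    ENNReal.ofReal ((J (momentumFlip i' q.1, q.2) - J q) ^ 2) with hF₁
  set F₀ : PhaseSpace N × WienerPair → ℝ≥0∞ := fun q =>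
    ENNReal.ofReal ((J (momentumFlip i q.1, q.2) - J q) ^ 2) with hF₀
  have hF₁m : Measurable F₁ := measurable_flipDiff_sq hω hl hβ hγ i' k s
  have hF₀m : Measurable F₀ := measurable_flipDiff_sq hω hl hβ hγ i k s
  have hΘ'm : Measurable fun q : PhaseSpace N × WienerPair => (momentumFlip i' q.1, q.2) :=
    ((measurable_momentumFlip i').comp measurable_fst).prodMk measurable_snd
  have hF₀Θm : Measurable fun q : PhaseSpace N × WienerPair => F₀ (momentumFlip i' q.1, q.2) := by
    have h := hF₀m.comp hΘ'm
    exact h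
  -- pointwise: (a - c)² ≤ 2 (b - a)² + 2 (c - b)²
  have hpt : ∀ x ω, ENNReal.ofReal ((J (x, ω) - J (momentumFlip i (momentumFlip i' x), ω)) ^ 2) ≤
      2 * F₁ (x, ω) + 2 * F₀ (momentumFlip i' x, ω) := by
    intro x ω
    simp only [hF₁, hF₀]
    set a := J (x, ω); set b := J (momentumFlip i' x, ω); set c := J (momentumFlip i (momentumFlip i' x), ω)
    have e : (a - c) ^ 2 ≤ 2 * (b - a) ^ 2 + 2 * (c - b) ^ 2 := by nlinarith [sq_nonneg (a - 2 * b + c)]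
    calc ENNReal.ofReal ((a - c) ^ 2) ≤ ENNReal.ofReal (2 * (b - a) ^ 2 + 2 * (c - b) ^ 2) := ENNReal.ofReal_le_ofReal e
      _ = 2 * ENNReal.ofReal ((b - a) ^ 2) + 2 * ENNReal.ofReal ((c - b) ^ 2) := by
          rw [ENNReal.ofReal_add (by positivity) (by positivity), ENNReal.ofReal_mul (by norm_num),
            ENNReal.ofReal_mul (by norm_num), ENNReal.ofReal_ofNat]
  -- integrate
  have hinner : ∀ x, ∫⁻ ω, (2 * F₁ (x, ω) + 2 * F₀ (momentumFlip i' x, ω)) ∂wienerPair =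
      2 * ∫⁻ ω, F₁ (x, ω) ∂wienerPair + 2 * ∫⁻ ω, F₀ (momentumFlip i' x, ω) ∂wienerPair := by
    intro x
    have m1 : Measurable fun ω => F₁ (x, ω) := hF₁m.comp measurable_prodMk_left
    have m0 : Measurable fun ω => F₀ (momentumFlip i' x, ω) := hF₀m.comp measurable_prodMk_left
    rw [lintegral_add_left (m1.const_mul 2), lintegral_const_mul 2 m1, lintegral_const_mul 2 m0]
  have hG₁m : Measurable fun x => ∫⁻ ω, F₁ (x, ω) ∂wienerPair := hF₁m.lintegral_prod_right'
  have hG₀m : Measurable fun y => ∫⁻ ω, F₀ (y, ω) ∂wienerPair := hF₀m.lintegral_prod_right'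
  have hG₀Θm : Measurable fun x => ∫⁻ ω, F₀ (momentumFlip i' x, ω) ∂wienerPair := by
    have h := hG₀m.comp (measurable_momentumFlip i')
    exact h
  have hflip : ∫⁻ x, ∫⁻ ω, F₀ (momentumFlip i' x, ω) ∂wienerPair ∂μ = ∫⁻ x, ∫⁻ ω, F₀ (x, ω) ∂wienerPair ∂μ :=
    lintegral_comp_momentumFlip_gibbs P N T i' hG₀m
  calc ∫⁻ x, ∫⁻ ω, ENNReal.ofReal ((J (x, ω) - J (momentumFlip i (momentumFlip i' x), ω)) ^ 2) ∂wienerPair ∂μ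
      ≤ ∫⁻ x, ∫⁻ ω, (2 * F₁ (x, ω) + 2 * F₀ (momentumFlip i' x, ω)) ∂wienerPair ∂μ :=
        lintegral_mono fun x => lintegral_mono fun ω => hpt x ω
    _ = ∫⁻ x, (2 * ∫⁻ ω, F₁ (x, ω) ∂wienerPair + 2 * ∫⁻ ω, F₀ (momentumFlip i' x, ω) ∂wienerPair) ∂μ :=
        lintegral_congr hinner
    _ = 2 * ∫⁻ x, ∫⁻ ω, F₁ (x, ω) ∂wienerPair ∂μ + 2 * ∫⁻ x, ∫⁻ ω, F₀ (momentumFlip i' x, ω) ∂wienerPair ∂μ := by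
        rw [lintegral_add_left (hG₁m.const_mul 2), lintegral_const_mul 2 hG₁m, lintegral_const_mul 2 hG₀Θm]
    _ = 2 * ∫⁻ x, ∫⁻ ω, F₁ (x, ω) ∂wienerPair ∂μ + 2 * ∫⁻ x, ∫⁻ ω, F₀ (x, ω) ∂wienerPair ∂μ := by rw [hflip]
    _ ≤ 2 * ENNReal.ofReal (ε / 4) + 2 * ENNReal.ofReal (ε / 4) :=
        add_le_add (mul_le_mul' le_rfl S1) (mul_le_mul' le_rfl S0)
    _ = ENNReal.ofReal ε := by
        rw [← ENNReal.ofReal_ofNat 2, ← ENNReal.ofReal_mul (by norm_num), ← ENNReal.ofReal_add (by positivity)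
          (by positivity)]
        ring_nf

/-- **STUB LC modulo the far-current fourth moment.** The registered stub `stub_lightConeWindow` VERBATIM, from
`FarCurrentFourthMoment` (piece FS-D2): pathwise flip-insensitivity (this file) ⟹ kernel flip-insensitivity (part 1,
`flipInsensitivity_of_pathwise`) ⟹ the light-cone window (`lightConeWindow_of_flipInsensitivity`, Aux3). -/
theorem stub_lightConeWindow_of_fourthMoment (hD2 : FarCurrentFourthMoment) :
    ∀ ω₂ lam β γ : ℝ, 0 < ω₂ → 0 < lam → 0 < β → 0 < γ → ∀ T : ℝ, 0 < T →
      ∃ t₀ η : ℕ → ℝ, (∀ N, 0 ≤ t₀ N) ∧ Tendsto t₀ atTop atTop ∧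
        Tendsto (fun N => η N * t₀ N) atTop (𝓝 0) ∧
        ∀ N : ℕ, 2 ≤ N → ∀ t : ℝ, 0 ≤ t → t ≤ t₀ N →
          |gkEntry (pinnedChain ω₂ lam β γ) N T 0 (N - 2) t| ≤ η N :=
  lightConeWindow_of_flipInsensitivity (flipInsensitivity_of_pathwise (pathwise_flipInsensitivity_of_fourthMoment hD2))

end FSAssembly

end Summit.AtomisticToContinuum.FouriersLaw.Theorems.NonBallistic

end
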